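import Literature.NumberTheory.EllipticCurves.TorsionPointNormalForms
import Literature.NumberTheory.EllipticCurves.GaloisAction
import HarnessLib

/-!
# A Galois-stable cyclic subgroup of order `3` or `5` gives a rational point of `X₀(3)`, `X₀(5)`

The classical moduli interpretation of the genus-`0` modular curves `X₀(3)`, `X₀(5)` and
`X_{sp}⁺(3)`, made explicit and proved by elementary algebra: for an elliptic curve `W` over a
field `F`, a Galois extension `L/F` (e.g. `L = F̄` for `F` perfect) and points of `W(L)`,

* `exists_hauptmodul_three_of_torsion`: a point `P ∈ W(F̄)` of order `3` with `σP = ±P` for all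
  `σ ∈ Gal(F̄/F)` (a rational cyclic `3`-isogeny, Borel image of `ρ̄₃`) gives `f ∈ F`, `f ≠ 0`,
  with `j(W) f = (f + 27)(f + 3)³` (Fricke's Hauptmodul of `X₀(3)`, `f = 3⁶(η(3z)/η(z))¹²`);
* `exists_hauptmodul_pair_three_of_torsion`: a Galois-stable pair of such subgroups (image of
  `ρ̄₃` in the normaliser of a split Cartan) gives two Hauptmodul values with sum and product in
  `F` (a rational point of `X_{sp}⁺(3)`);
* `exists_hauptmodul_five_of_torsion`: a point of order `5` with `σP ∈ {±P, ±2P}` (Borel image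
  of `ρ̄₅`) gives `H ∈ F`, `H ≠ 0`, with `j(W) H = (H² + 10H + 5)³` (Klein's Hauptmodul of
  `X₀(5)`, `H = 5³(η(5z)/η(z))⁶`).

Method: the normal forms of `TorsionPointNormalForms` at `P` (`y² + a₁'xy + a₃'y = x³`, resp. the
Tate normal form `E(t, t)`), whose invariants `τ₃ = a₁'³/a₃'`, `t = -a₂'³/a₃'²` are rational
functions of the coordinates of `P` with coefficients in `F`, hence Galois-equivariant
(`map_tau_three`, `map_tate_t`); `τ₃(-P) = τ₃(P)`, `t(-P) = t(P)`, `t(2P) = -1/t(P)` make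
`f = τ₃ - 27` and `H = t - 11 - 1/t` Galois-invariant, and Galois descent
(`InfiniteGalois.mem_range_algebraMap_iff_fixed`, for `L/F` Galois) puts them in `F`. These are the
inputs
"`E` gives a `K`-point of `X(b3, b5) = X₀(15)`, resp. of `X(s3, b5)`" of
[Thorne 2019, proof of Lemma 3]. [folklore]
-/

noncomputable section

open scoped Classical

namespace WeierstrassCurve

universe u

variable {F : Type u} [Field F] (W : WeierstrassCurve F) {L : Type u} [Field L] [Algebra F L]

section GaloisCompat

variable {W}

/-- The invariant `τ₃(P) = (a₁ + 2λ_P)³/(y_P - ȳ_P)` is Galois-equivariant: for `σ ∈ Aut(F̄/F)`,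
`σ(τ₃(x, y)) = τ₃(σx, σy)` on `W_{F̄}` (the coefficients of `W` are fixed). [folklore] -/
theorem map_tau_three (σ : L →ₐ[F] L) (x y : L) :
    σ ((((W.baseChange L).a₁ +
        2 * (W.baseChange L).toAffine.slope x x y y) ^ 3) /
        (y - (W.baseChange L).toAffine.negY x y)) =
      ((W.baseChange L).a₁ +
        2 * (W.baseChange L).toAffine.slope (σ x) (σ x) (σ y) (σ y)) ^ 3 /
        (σ y - (W.baseChange L).toAffine.negY (σ x) (σ y)) := by
  have ha₁ : σ (W.baseChange L).a₁ = (W.baseChange L).a₁ :=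
    σ.commutes W.a₁
  rw [map_div₀, map_pow, map_add, map_mul, map_sub, ha₁, Affine.baseChange_slope,
    Affine.baseChange_negY, map_ofNat]

/-- The Tate invariant `t(P) = -(a₂ - λa₁ + 3x - λ²)³/(y - ȳ)²` is Galois-equivariant. [folklore] -/
theorem map_tate_t (σ : L →ₐ[F] L) (x y : L) :
    σ (-((W.baseChange L).a₂ -
          (W.baseChange L).toAffine.slope x x y y *
            (W.baseChange L).a₁ + 3 * x -
          (W.baseChange L).toAffine.slope x x y y ^ 2) ^ 3 /
        (y - (W.baseChange L).toAffine.negY x y) ^ 2) =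
      -((W.baseChange L).a₂ -
          (W.baseChange L).toAffine.slope (σ x) (σ x) (σ y) (σ y) *
            (W.baseChange L).a₁ + 3 * σ x -
          (W.baseChange L).toAffine.slope (σ x) (σ x) (σ y) (σ y) ^ 2) ^ 3 /
        (σ y - (W.baseChange L).toAffine.negY (σ x) (σ y)) ^ 2 := by
  have ha₁ : σ (W.baseChange L).a₁ = (W.baseChange L).a₁ :=
    σ.commutes W.a₁
  have ha₂ : σ (W.baseChange L).a₂ = (W.baseChange L).a₂ :=
    σ.commutes W.a₂
  rw [map_div₀, map_pow, map_neg, map_pow, map_sub, map_sub, map_add, map_sub, map_mul, map_mul,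
    map_pow, ha₁, ha₂, Affine.baseChange_slope, Affine.baseChange_negY, map_ofNat]

end GaloisCompat

/-! ### Level `3` -/

/-- **The Hauptmodul value at a point of order `3`.** On `W_{F̄}`, if the affine point
`P = (x₀, y₀)` satisfies `2P = -P`, then `P ≠ -P`, and `f = τ₃(P) - 27`,
`τ₃(P) = (a₁ + 2λ_P)³/(y₀ - ȳ₀)` (`= a₁'³/a₃'` for the normal form `y² + a₁'xy + a₃'y = x³` at `P`),
satisfies `f ≠ 0` and `j · f = (f + 27)(f + 3)³`. [folklore] -/
theorem hauptmodul_three_of_order_three [W.IsElliptic] {x₀ y₀ : L}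
    {h : (W.baseChange L).toAffine.Nonsingular x₀ y₀}
    (h3 : (Affine.Point.some _ _ h : (W.baseChange L).toAffine.Point) + .some _ _ h = -.some _ _
        h) :
    y₀ ≠ (W.baseChange L).toAffine.negY x₀ y₀ ∧
      ((W.baseChange L).a₁ + 2 * (W.baseChange L).toAffine.slope x₀ x₀ y₀ y₀) ^ 3 / (y₀ -
          (W.baseChange L).toAffine.negY x₀ y₀) - 27 ≠ 0 ∧
      algebraMap F L W.j * (((W.baseChange L).a₁ + 2 * (W.baseChange L).toAffine.slope x₀ x₀ y₀
          y₀) ^ 3 / (y₀ - (W.baseChange L).toAffine.negY x₀ y₀) - 27) =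
        (((W.baseChange L).a₁ + 2 * (W.baseChange L).toAffine.slope x₀ x₀ y₀ y₀) ^ 3 / (y₀ -
            (W.baseChange L).toAffine.negY x₀ y₀) - 27 + 27) *
          (((W.baseChange L).a₁ + 2 * (W.baseChange L).toAffine.slope x₀ x₀ y₀ y₀) ^ 3 / (y₀ -
              (W.baseChange L).toAffine.negY x₀ y₀) - 27 + 3) ^ 3 := by
  haveI : (W.baseChange L).IsElliptic := by rw [baseChange]; infer_instance
  -- `P ≠ -P`
  have hy : y₀ ≠ (W.baseChange L).toAffine.negY x₀ y₀ := by
    intro hyy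
    have hneg : -(Affine.Point.some _ _ h : (W.baseChange L).toAffine.Point) = .some _ _ h := by
      rw [Affine.Point.neg_some]
      exact (Affine.Point.some.injEq _ _ _ _ _ _).mpr ⟨rfl, hyy.symm⟩
    rw [hneg, add_eq_left] at h3
    exact Affine.Point.some_ne_zero _ h3
  refine ⟨hy, ?_⟩
  -- the normal form at `P`
  have hV' := variableChange_tangent_eq (W := (W.baseChange L)) h.1 hy
  obtain ⟨h₀, hP'⟩ := pointEquiv_tangent_some (W := (W.baseChange L)) h
  revert hV'; revert hP'; revert h₀
  generalize (⟨1, x₀, (W.baseChange L).toAffine.slope x₀ x₀ y₀ y₀, y₀⟩ : VariableChange L) = C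
  intro h₀ hP' hV'
  have h4' : (C • (W.baseChange L)).a₄ = 0 := by rw [hV']
  have h6' : (C • (W.baseChange L)).a₆ = 0 := by rw [hV']
  have h3' : (C • (W.baseChange L)).a₃ ≠ 0 := by rw [hV']; exact sub_ne_zero.2 hy
  have h3'' := congrArg (VariableChange.pointEquiv (W.baseChange L) C) h3
  rw [map_add, map_neg, hP'] at h3''
  have hA2 : (C • (W.baseChange L)).a₂ = 0 := a₂_eq_zero_of_two_smul_eq_neg h4' h6' h3' h3''
  obtain ⟨-, hf0, hjf⟩ := j_mul_hauptmodul_three (W := C • (W.baseChange L)) hA2 h4' h6'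
  rw [variableChange_j] at hjf
  have hτ : (C • (W.baseChange L)).a₁ ^ 3 / (C • (W.baseChange L)).a₃ =
      ((W.baseChange L).a₁ + 2 * (W.baseChange L).toAffine.slope x₀ x₀ y₀ y₀) ^ 3 / (y₀ -
          (W.baseChange L).toAffine.negY x₀ y₀) := by
    rw [hV']
  rw [hτ] at hf0 hjf
  have hj : algebraMap F L W.j = (W.baseChange L).j := (W.map_j _).symm
  rw [hj]
  exact ⟨hf0, hjf⟩

/-- The coordinates of `σP` for `σP = ±Q`: `σ x_P = x_Q` and `σ y_P ∈ {y_Q, ȳ_Q}`; in either case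
`τ₃(σ x_P, σ y_P) = τ₃(Q)` (`τ₃(-Q) = τ₃(Q)`). [folklore] -/
theorem tau_three_smul_eq [W.IsElliptic] (σ : L ≃ₐ[F] L) {x₀ y₀ x₁ y₁ : L}
    {h : (W.baseChange L).toAffine.Nonsingular x₀ y₀} {h₁ : (W.baseChange L).toAffine.Nonsingular
        x₁ y₁}
    (hy₁ : y₁ ≠ (W.baseChange L).toAffine.negY x₁ y₁)
    (hσ : σ • (Affine.Point.some _ _ h : (W.baseChange L).toAffine.Point) = .some _ _ h₁ ∨
      σ • (Affine.Point.some _ _ h : (W.baseChange L).toAffine.Point) = -.some _ _ h₁) :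
    σ (((W.baseChange L).a₁ + 2 * (W.baseChange L).toAffine.slope x₀ x₀ y₀ y₀) ^ 3 / (y₀ -
        (W.baseChange L).toAffine.negY x₀ y₀)) =
      ((W.baseChange L).a₁ + 2 * (W.baseChange L).toAffine.slope x₁ x₁ y₁ y₁) ^ 3 / (y₁ -
          (W.baseChange L).toAffine.negY x₁ y₁) := by
  have key := map_tau_three (W := W) (σ : L →ₐ[F] L) x₀ y₀
  rw [AlgEquiv.coe_toAlgHom] at key
  rw [key]
  rcases hσ with hσP | hσP
  · have hc : σ x₀ = x₁ ∧ σ y₀ = y₁ := by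
      change Affine.Point.map (σ : L →ₐ[F] L) (Affine.Point.some _ _ h) = _ at hσP
      rw [Affine.Point.map_some] at hσP
      simpa only [Affine.Point.some.injEq, AlgEquiv.coe_toAlgHom] using hσP
    rw [hc.1, hc.2]
  · have hc : σ x₀ = x₁ ∧ σ y₀ = (W.baseChange L).toAffine.negY x₁ y₁ := by
      change Affine.Point.map (σ : L →ₐ[F] L) (Affine.Point.some _ _ h) = _ at hσP
      rw [Affine.Point.map_some, Affine.Point.neg_some] at hσP
      simpa only [Affine.Point.some.injEq, AlgEquiv.coe_toAlgHom] using hσP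
    rw [hc.1, hc.2]
    exact tau_three_negY hy₁

/-- **A Galois-stable subgroup of order `3` gives an `F`-point of `X₀(3)`.** Let `W/F` be an
elliptic curve over a perfect field and `P ∈ W(F̄)` a point of order `3` whose subgroup
`{O, ±P}` is `Gal(F̄/F)`-stable (`σP = ±P` for all `σ`). Then the Hauptmodul value
`f = τ₃(P) - 27`, `τ₃ = a₁'³/a₃'` for the normal form `y² + a₁'xy + a₃'y = x³` at `P`, lies in `F`,
is non-zero, and `j(W) · f = (f + 27)(f + 3)³`. (Galois descent: `τ₃(σP) = σ(τ₃(P))` and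
`τ₃(-P) = τ₃(P)`.) This is the classical statement that a rational cyclic `3`-isogeny is a
rational point of `X₀(3)`, made explicit with Fricke's Hauptmodul. [folklore] -/
theorem exists_hauptmodul_three_of_torsion [IsGalois F L] [W.IsElliptic]
    {P : (W.baseChange L).toAffine.Point} (hP : P ≠ 0) (h3 : P + P = -P)
    (hσ : ∀ σ : L ≃ₐ[F] L, σ • P = P ∨ σ • P = -P) :
    ∃ f : F, f ≠ 0 ∧ W.j * f = (f + 27) * (f + 3) ^ 3 := by
  rcases P with _ | ⟨x₀, y₀, h⟩
  · exact absurd rfl hP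
  obtain ⟨hy, hf0, hjf⟩ := hauptmodul_three_of_order_three W h3
  have hfix : ∀ σ : L ≃ₐ[F] L,
      σ (((W.baseChange L).a₁ + 2 * (W.baseChange L).toAffine.slope x₀ x₀ y₀ y₀) ^ 3 / (y₀ -
          (W.baseChange L).toAffine.negY x₀ y₀)) =
        ((W.baseChange L).a₁ + 2 * (W.baseChange L).toAffine.slope x₀ x₀ y₀ y₀) ^ 3 / (y₀ -
            (W.baseChange L).toAffine.negY x₀ y₀) :=
    fun σ => tau_three_smul_eq W σ hy (hσ σ)
  obtain ⟨f', hf'⟩ := (InfiniteGalois.mem_range_algebraMap_iff_fixed _).mpr hfix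
  refine ⟨f' - 27, ?_, ?_⟩
  · intro h0
    apply hf0
    rw [← hf', ← map_ofNat (algebraMap F L) 27, ← map_sub, h0, map_zero]
  · apply (algebraMap F L).injective
    simp only [map_mul, map_add, map_pow, map_sub, map_ofNat, hf']
    exact hjf

/-- **A Galois-stable pair of subgroups of order `3` gives an `F`-point of `X_{sp}⁺(3)`.** Let
`P, Q ∈ W(F̄)` be points of order `3` such that every `σ ∈ Gal(F̄/F)` either maps
`P ↦ ±P`, `Q ↦ ±Q` or maps `P ↦ ±Q`, `Q ↦ ±P` (the pair of lines `{⟨P⟩, ⟨Q⟩}` is Galois-stable: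
image of `ρ̄₃` in the normaliser of a split Cartan subgroup). Then the Hauptmodul values
`f_P, f_Q ∈ F̄` of the two lines (`f ≠ 0`, `j f = (f + 27)(f + 3)³`) have sum and product in `F`.
[folklore] -/
theorem exists_hauptmodul_pair_three_of_torsion [IsGalois F L] [W.IsElliptic]
    {P Q : (W.baseChange L).toAffine.Point} (hP : P ≠ 0) (hP3 : P + P = -P) (hQ : Q ≠ 0) (hQ3 : Q
        + Q = -Q)
    (hσ : ∀ σ : L ≃ₐ[F] L,
      ((σ • P = P ∨ σ • P = -P) ∧ (σ • Q = Q ∨ σ • Q = -Q)) ∨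
        ((σ • P = Q ∨ σ • P = -Q) ∧ (σ • Q = P ∨ σ • Q = -P))) :
    ∃ (s z : F) (f₀ f₁ : L), algebraMap F L s = f₀ + f₁ ∧ algebraMap F L z = f₀ * f₁ ∧
      f₀ ≠ 0 ∧ f₁ ≠ 0 ∧ algebraMap F L W.j * f₀ = (f₀ + 27) * (f₀ + 3) ^ 3 ∧
      algebraMap F L W.j * f₁ = (f₁ + 27) * (f₁ + 3) ^ 3 := by
  rcases P with _ | ⟨x₀, y₀, h⟩
  · exact absurd rfl hP
  rcases Q with _ | ⟨x₁, y₁, h₁⟩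
  · exact absurd rfl hQ
  obtain ⟨hy, hf0, hjf⟩ := hauptmodul_three_of_order_three W hP3
  obtain ⟨hy₁, hg0, hjg⟩ := hauptmodul_three_of_order_three W hQ3
  have hperm : ∀ σ : L ≃ₐ[F] L,
      (σ (((W.baseChange L).a₁ + 2 * (W.baseChange L).toAffine.slope x₀ x₀ y₀ y₀) ^ 3 / (y₀ -
          (W.baseChange L).toAffine.negY x₀ y₀)) =
          ((W.baseChange L).a₁ + 2 * (W.baseChange L).toAffine.slope x₀ x₀ y₀ y₀) ^ 3 / (y₀ -
              (W.baseChange L).toAffine.negY x₀ y₀) ∧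
        σ (((W.baseChange L).a₁ + 2 * (W.baseChange L).toAffine.slope x₁ x₁ y₁ y₁) ^ 3 / (y₁ -
            (W.baseChange L).toAffine.negY x₁ y₁)) =
          ((W.baseChange L).a₁ + 2 * (W.baseChange L).toAffine.slope x₁ x₁ y₁ y₁) ^ 3 / (y₁ -
              (W.baseChange L).toAffine.negY x₁ y₁)) ∨
      (σ (((W.baseChange L).a₁ + 2 * (W.baseChange L).toAffine.slope x₀ x₀ y₀ y₀) ^ 3 / (y₀ -
          (W.baseChange L).toAffine.negY x₀ y₀)) =
          ((W.baseChange L).a₁ + 2 * (W.baseChange L).toAffine.slope x₁ x₁ y₁ y₁) ^ 3 / (y₁ -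
              (W.baseChange L).toAffine.negY x₁ y₁) ∧
        σ (((W.baseChange L).a₁ + 2 * (W.baseChange L).toAffine.slope x₁ x₁ y₁ y₁) ^ 3 / (y₁ -
            (W.baseChange L).toAffine.negY x₁ y₁)) =
          ((W.baseChange L).a₁ + 2 * (W.baseChange L).toAffine.slope x₀ x₀ y₀ y₀) ^ 3 / (y₀ -
              (W.baseChange L).toAffine.negY x₀ y₀)) := by
    intro σ
    rcases hσ σ with ⟨hσP, hσQ⟩ | ⟨hσP, hσQ⟩
    · exact Or.inl ⟨tau_three_smul_eq W σ hy hσP, tau_three_smul_eq W σ hy₁ hσQ⟩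
    · exact Or.inr ⟨tau_three_smul_eq W σ hy₁ hσP, tau_three_smul_eq W σ hy hσQ⟩
  revert hf0 hjf hg0 hjg hperm
  generalize ((W.baseChange L).a₁ + 2 * (W.baseChange L).toAffine.slope x₀ x₀ y₀ y₀) ^ 3 / (y₀ -
      (W.baseChange L).toAffine.negY x₀ y₀) = u
  generalize ((W.baseChange L).a₁ + 2 * (W.baseChange L).toAffine.slope x₁ x₁ y₁ y₁) ^ 3 / (y₁ -
      (W.baseChange L).toAffine.negY x₁ y₁) = v
  intro hf0 hjf hg0 hjg hperm
  have hs : ∀ σ : L ≃ₐ[F] L, σ (u - 27 + (v - 27)) = u - 27 + (v - 27) := by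
    intro σ
    rw [map_add, map_sub, map_sub, map_ofNat]
    rcases hperm σ with ⟨e₁, e₂⟩ | ⟨e₁, e₂⟩ <;> rw [e₁, e₂]; ring
  have hz : ∀ σ : L ≃ₐ[F] L, σ ((u - 27) * (v - 27)) = (u - 27) * (v - 27) := by
    intro σ
    rw [map_mul, map_sub, map_sub, map_ofNat]
    rcases hperm σ with ⟨e₁, e₂⟩ | ⟨e₁, e₂⟩ <;> rw [e₁, e₂]; ring
  obtain ⟨s, hs'⟩ := (InfiniteGalois.mem_range_algebraMap_iff_fixed _).mpr hs
  obtain ⟨z, hz'⟩ := (InfiniteGalois.mem_range_algebraMap_iff_fixed _).mpr hz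
  exact ⟨s, z, u - 27, v - 27, hs', hz', hf0, hg0, hjf, hjg⟩

/-! ### Level `5` -/

/-- `H(t) = (t² - 11t - 1)/t = t - 11 - 1/t` is invariant under the deck involution `t ↦ -1/t`
of `X₁(5) → X₀(5)`. [folklore] -/
theorem hauptmodul_five_eq_of_mul_eq_neg_one {u v : L} (huv : u * v = -1) :
    (u ^ 2 - 11 * u - 1) / u = (v ^ 2 - 11 * v - 1) / v := by
  have hu : u ≠ 0 := by rintro rfl; norm_num at huv
  have hv : v ≠ 0 := by rintro rfl; norm_num at huv
  field_simp
  linear_combination (u - v) * huv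

/-- **A Galois-stable subgroup of order `5` gives an `F`-point of `X₀(5)`.** Let `W/F` be an
elliptic curve over a perfect field and `P ∈ W(F̄)` a point of order `5` (`2P ≠ -P`, `4P = -P`)
whose subgroup `{O, ±P, ±2P}` is `Gal(F̄/F)`-stable. Then the Hauptmodul value
`H = t - 11 - 1/t`, `t = -a₂'³/a₃'²` the Tate parameter of the normal form
`y² + a₁'xy + a₃'y = x³ + a₂'x²` at `P` (`= E(t,t)` up to scaling), lies in `F`, is non-zero, and
`j(W) · H = (H² + 10H + 5)³`. (Galois descent: `t(σP) = σ(t(P))`, `t(-P) = t(P)`,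
`t(2P) = -1/t(P)`.) This is the classical statement that a rational cyclic `5`-isogeny is a
rational point of `X₀(5)`, made explicit with Klein's icosahedral Hauptmodul. [folklore] -/
theorem exists_hauptmodul_five_of_torsion [IsGalois F L] [W.IsElliptic]
    {P : (W.baseChange L).toAffine.Point} (hP : P ≠ 0) (hne : P + P ≠ -P) (h5 : P + P + (P + P) =
        -P)
    (hσ : ∀ σ : L ≃ₐ[F] L, σ • P = P ∨ σ • P = -P ∨ σ • P = P + P ∨ σ • P = -(P + P)) :
    ∃ g : F, g ≠ 0 ∧ W.j * g = (g ^ 2 + 10 * g + 5) ^ 3 := by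
  haveI : (W.baseChange L).IsElliptic := by rw [baseChange]; infer_instance
  rcases P with _ | ⟨x₀, y₀, h⟩
  · exact absurd rfl hP
  -- `2P` is an affine point (`2P = O` would give `P = -4P = O`)
  obtain ⟨x₁, y₁, h₁, hQ⟩ : ∃ x₁ y₁ h₁, (Affine.Point.some _ _ h : (W.baseChange
      L).toAffine.Point) +
      .some _ _ h = .some x₁ y₁ h₁ := by
    rcases hPP : (Affine.Point.some _ _ h : (W.baseChange L).toAffine.Point) + .some _ _ h with
        _ | ⟨x₁, y₁, h₁⟩
    · rw [hPP, ← Affine.Point.zero_def, add_zero] at h5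
      exact absurd (neg_eq_zero.1 h5.symm) hP
    · exact ⟨x₁, y₁, h₁, hPP⟩
  -- `P ≠ -P` (else `2P = O`)
  have hy : y₀ ≠ (W.baseChange L).toAffine.negY x₀ y₀ := by
    intro hyy
    have hneg : -(Affine.Point.some _ _ h : (W.baseChange L).toAffine.Point) = .some _ _ h := by
      rw [Affine.Point.neg_some]
      exact (Affine.Point.some.injEq _ _ _ _ _ _).mpr ⟨rfl, hyy.symm⟩
    have h2 : (Affine.Point.some _ _ h : (W.baseChange L).toAffine.Point) + .some _ _ h = 0 := by
      nth_rewrite 2 [← hneg]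
      exact add_neg_cancel _
    rw [h2] at hQ
    exact Affine.Point.some_ne_zero _ hQ.symm
  -- `2P ≠ -2P` (else `4P = O`)
  have hy₁ : y₁ ≠ (W.baseChange L).toAffine.negY x₁ y₁ := by
    intro hyy
    have hneg : -(Affine.Point.some _ _ h₁ : (W.baseChange L).toAffine.Point) = .some _ _ h₁ := by
      rw [Affine.Point.neg_some]
      exact (Affine.Point.some.injEq _ _ _ _ _ _).mpr ⟨rfl, hyy.symm⟩
    have h2 : (Affine.Point.some _ _ h₁ : (W.baseChange L).toAffine.Point) + .some _ _ h₁ = 0 := by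
      nth_rewrite 2 [← hneg]
      exact add_neg_cancel _
    rw [hQ, h2] at h5
    exact hP (neg_eq_zero.1 h5.symm)
  -- the normal form at `P`, and `2P` in it
  have hV' := variableChange_tangent_eq (W := (W.baseChange L)) h.1 hy
  obtain ⟨h₀, hP'⟩ := pointEquiv_tangent_some (W := (W.baseChange L)) h
  have hQ' := VariableChange.pointEquiv_some (W.baseChange L) (⟨1, x₀, (W.baseChange
      L).toAffine.slope x₀ x₀ y₀ y₀, y₀⟩ : VariableChange L) h₁
  have htQ := tate_t_toXY (W := (W.baseChange L)) (⟨1, x₀, (W.baseChange L).toAffine.slope x₀ x₀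
      y₀ y₀, y₀⟩ : VariableChange L) rfl h₁.1 hy₁
  revert htQ; revert hQ'; revert hV'; revert hP'; revert h₀
  generalize (⟨1, x₀, (W.baseChange L).toAffine.slope x₀ x₀ y₀ y₀, y₀⟩ : VariableChange L) = C
  intro h₀ hP' hV' hQ' htQ
  have h4' : (C • (W.baseChange L)).a₄ = 0 := by rw [hV']
  have h6' : (C • (W.baseChange L)).a₆ = 0 := by rw [hV']
  have h3' : (C • (W.baseChange L)).a₃ ≠ 0 := by rw [hV']; exact sub_ne_zero.2 hy
  -- the order conditions in the normal form
  have hne' : VariableChange.pointEquiv (W.baseChange L) C (.some _ _ h) +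
      VariableChange.pointEquiv (W.baseChange L) C (.some _ _ h) ≠ -VariableChange.pointEquiv
          (W.baseChange L) C (.some _ _ h) := by
    rw [← map_add, ← map_neg]
    exact fun e => hne ((VariableChange.pointEquiv (W.baseChange L) C).injective e)
  have h5' := congrArg (VariableChange.pointEquiv (W.baseChange L) C) h5
  rw [map_add, map_add, map_neg, hP'] at h5'
  rw [hP'] at hne'
  obtain ⟨ha₂, hDQ, hR⟩ := tate_relation_of_order_five h4' h6' h3' hne' h5'
  obtain ⟨ht0, ht11, hjt⟩ := j_mul_tate_five (W := C • (W.baseChange L)) h4' h6' ha₂ h3' hR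
  obtain ⟨hH0, hjH⟩ := j_mul_hauptmodul_five ht0 ht11 hjt
  rw [variableChange_j] at hjH
  -- the Tate parameter in the coordinates of `P`
  have ht : -(C • (W.baseChange L)).a₂ ^ 3 / (C • (W.baseChange L)).a₃ ^ 2 =
      (-((W.baseChange L).a₂ - (W.baseChange L).toAffine.slope x₀ x₀ y₀ y₀ * (W.baseChange L).a₁ +
          3 * x₀ - (W.baseChange L).toAffine.slope x₀ x₀ y₀ y₀ ^ 2) ^ 3 /
          (y₀ - (W.baseChange L).toAffine.negY x₀ y₀) ^ 2) := by
    rw [hV']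
  rw [ht] at hH0 hjH
  -- `t(2P) · t(P) = -1`
  have h2P := congrArg (VariableChange.pointEquiv (W.baseChange L) C) hQ
  rw [map_add, hP', hQ'] at h2P
  obtain ⟨hQ'', h2⟩ := two_smul_zero_zero h4' h6' h3'
  rw [h2] at h2P
  obtain ⟨hX1, hY1⟩ := (Affine.Point.some.injEq _ _ _ _ _ _).mp h2P
  rw [← hX1, ← hY1] at htQ
  have hd := tate_t_double (W := C • (W.baseChange L)) h4' ha₂ h3' hDQ hR
  rw [htQ, ht] at hd
  -- Galois moves `t(P)` to `t(±P) = t(P)` or to `t(±2P) = t(2P)`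
  have hT : ∀ σ : L ≃ₐ[F] L,
      σ (-((W.baseChange L).a₂ - (W.baseChange L).toAffine.slope x₀ x₀ y₀ y₀ * (W.baseChange L).a₁
          + 3 * x₀ - (W.baseChange L).toAffine.slope x₀ x₀ y₀ y₀ ^ 2) ^ 3 /
          (y₀ - (W.baseChange L).toAffine.negY x₀ y₀) ^ 2) =
        (-((W.baseChange L).a₂ - (W.baseChange L).toAffine.slope x₀ x₀ y₀ y₀ * (W.baseChange L).a₁
            + 3 * x₀ - (W.baseChange L).toAffine.slope x₀ x₀ y₀ y₀ ^ 2) ^ 3 /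
          (y₀ - (W.baseChange L).toAffine.negY x₀ y₀) ^ 2) ∨
      σ (-((W.baseChange L).a₂ - (W.baseChange L).toAffine.slope x₀ x₀ y₀ y₀ * (W.baseChange L).a₁
          + 3 * x₀ - (W.baseChange L).toAffine.slope x₀ x₀ y₀ y₀ ^ 2) ^ 3 /
          (y₀ - (W.baseChange L).toAffine.negY x₀ y₀) ^ 2) =
        (-((W.baseChange L).a₂ - (W.baseChange L).toAffine.slope x₁ x₁ y₁ y₁ * (W.baseChange L).a₁
            + 3 * x₁ - (W.baseChange L).toAffine.slope x₁ x₁ y₁ y₁ ^ 2) ^ 3 /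
          (y₁ - (W.baseChange L).toAffine.negY x₁ y₁) ^ 2) := by
    intro σ
    have key := map_tate_t (W := W) (σ : L →ₐ[F] L) x₀ y₀
    rw [AlgEquiv.coe_toAlgHom] at key
    rw [key]
    rcases hσ σ with hσP | hσP | hσP | hσP
    · left
      have hc : σ x₀ = x₀ ∧ σ y₀ = y₀ := by
        change Affine.Point.map (σ : L →ₐ[F] L) (Affine.Point.some _ _ h) = _ at hσP
        rw [Affine.Point.map_some] at hσP
        simpa only [Affine.Point.some.injEq, AlgEquiv.coe_toAlgHom] using hσP
      rw [hc.1, hc.2]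
    · left
      have hc : σ x₀ = x₀ ∧ σ y₀ = (W.baseChange L).toAffine.negY x₀ y₀ := by
        change Affine.Point.map (σ : L →ₐ[F] L) (Affine.Point.some _ _ h) = _ at hσP
        rw [Affine.Point.map_some, Affine.Point.neg_some] at hσP
        simpa only [Affine.Point.some.injEq, AlgEquiv.coe_toAlgHom] using hσP
      rw [hc.1, hc.2]
      exact tate_t_negY hy
    · right
      have hc : σ x₀ = x₁ ∧ σ y₀ = y₁ := by
        change Affine.Point.map (σ : L →ₐ[F] L) (Affine.Point.some _ _ h) = _ at hσP
        rw [Affine.Point.map_some, hQ] at hσP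
        simpa only [Affine.Point.some.injEq, AlgEquiv.coe_toAlgHom] using hσP
      rw [hc.1, hc.2]
    · right
      have hc : σ x₀ = x₁ ∧ σ y₀ = (W.baseChange L).toAffine.negY x₁ y₁ := by
        change Affine.Point.map (σ : L →ₐ[F] L) (Affine.Point.some _ _ h) = _ at hσP
        rw [Affine.Point.map_some, hQ, Affine.Point.neg_some] at hσP
        simpa only [Affine.Point.some.injEq, AlgEquiv.coe_toAlgHom] using hσP
      rw [hc.1, hc.2]
      exact tate_t_negY hy₁
  -- hence `H = t - 11 - 1/t` is Galois invariant
  revert hH0 hjH hd hT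
  generalize (-((W.baseChange L).a₂ - (W.baseChange L).toAffine.slope x₀ x₀ y₀ y₀ * (W.baseChange
      L).a₁ + 3 * x₀ - (W.baseChange L).toAffine.slope x₀ x₀ y₀ y₀ ^ 2) ^ 3 /
          (y₀ - (W.baseChange L).toAffine.negY x₀ y₀) ^ 2) = u
  generalize (-((W.baseChange L).a₂ - (W.baseChange L).toAffine.slope x₁ x₁ y₁ y₁ * (W.baseChange
      L).a₁ + 3 * x₁ - (W.baseChange L).toAffine.slope x₁ x₁ y₁ y₁ ^ 2) ^ 3 /
          (y₁ - (W.baseChange L).toAffine.negY x₁ y₁) ^ 2) = v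
  intro hH0 hjH hd hT
  have hfix : ∀ σ : L ≃ₐ[F] L, σ ((u ^ 2 - 11 * u - 1) / u) = (u ^ 2 - 11 * u - 1) / u := by
    intro σ
    rw [map_div₀, map_sub, map_sub, map_pow, map_mul, map_ofNat, map_one]
    rcases hT σ with e | e <;> rw [e]
    exact hauptmodul_five_eq_of_mul_eq_neg_one hd
  obtain ⟨g, hg⟩ := (InfiniteGalois.mem_range_algebraMap_iff_fixed _).mpr hfix
  refine ⟨g, ?_, ?_⟩
  · intro h0
    apply hH0
    rw [← hg, h0, map_zero]
  · apply (algebraMap F L).injective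
    have hj : algebraMap F L W.j = (W.baseChange L).j := (W.map_j _).symm
    simp only [map_mul, map_add, map_pow, map_ofNat, hj, hg]
    exact hjH

end WeierstrassCurve

end
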